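import Mathlib
import HarnessLib
import Summits.SmoothPoincare4.SmoothPoincare4.Theses.IsotropicCorkBracketing

/-!
# Route IsotropicCorkBracketing — item `Assembly` (stmt-SmoothPoincare4-9834)

The assembly of route IsotropicCorkBracketing: the pure-logic chain

  `IsotropicFormPositive → ConformalPic → HamiltonChenTangZhu → SmoothPoincare4`.

Given a closed smooth `M ≃ₕ S⁴` (the summit's binders), `M` is compact
(`compactSpace_of_homotopyEquiv_sphere_four_holds`) and simply connected (`π₁(S⁴) = 1`,
`simplyConnectedSpace_sphere_four_holds`, transported along the homotopy equivalence); with the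
Borel σ-algebra chosen on `M`, `IsotropicFormPositive` supplies a Riemannian metric `G` with
Levi-Civita connection and positive definite isotropic Yamabe form, `ConformalPic` turns it into a
metric of positive isotropic curvature, and `HamiltonChenTangZhu` (Hamilton 1997 Cor. 1.2(a) /
Chen–Tang–Zhu 2012) yields the diffeomorphism `M ≅ S⁴`.

Sources: ChenZhu2014 (arXiv:1206.5051) Cor. 2.2, §3; Hamilton1997; ChenTangZhu2012; Hatcher,
*Algebraic Topology* (2002) Prop. 1.14.  The analytic content lives in the three hypotheses.
-/

-- the prescribed namespace `Summit.<P>.<Sub>.…` duplicates `SmoothPoincare4` (P = Sub)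
set_option linter.dupNamespace false

namespace Summit.SmoothPoincare4.SmoothPoincare4.Theorems

open Summit.SmoothPoincare4.SmoothPoincare4.Theses.IsotropicCorkBracketing

/-- **Item `Assembly` (stmt-SmoothPoincare4-9834) of route IsotropicCorkBracketing.**
`IsotropicFormPositive → ConformalPic → HamiltonChenTangZhu → SmoothPoincare4`: for a closed smooth
`M ≃ₕ S⁴`, discharge compactness and simple connectivity from the homotopy equivalence, equip `M`
with its Borel σ-algebra, take the metric with positive definite isotropic Yamabe form
(`IsotropicFormPositive`), conformally change it to a PIC metric (`ConformalPic`), and recognise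
`M ≅ S⁴` (`HamiltonChenTangZhu`). -/
theorem isotropicCorkBracketing_assembly_proof :
    Summit.SmoothPoincare4.SmoothPoincare4.Theses.IsotropicCorkBracketing.Assembly := by
  unfold Assembly
  intro hT hC hH
  unfold _root_.SmoothPoincare4 Literature.SPC4.SmoothPoincareConjectureFour
    ContinuousMap.HomotopyEquiv.NonemptyDiffeomorphSphere
  intro M _ _ _ _ _ e
  haveI : CompactSpace M :=
    Literature.Topology.FourManifolds.compactSpace_of_homotopyEquiv_sphere_four_holds M e
  haveI : SimplyConnectedSpace (Metric.sphere (0 : EuclideanSpace ℝ (Fin 5)) 1) :=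
    Literature.Topology.FourManifolds.simplyConnectedSpace_sphere_four_holds
  haveI : SimplyConnectedSpace M := e.simplyConnectedSpace
  letI : MeasurableSpace M := borel M
  haveI : BorelSpace M := ⟨rfl⟩
  obtain ⟨G, hG, hLC, hpos⟩ := hT M e
  haveI := hLC
  obtain ⟨G', hG', hpic⟩ := hC M G hG hpos
  exact hH M ⟨G', hG', hpic⟩

end Summit.SmoothPoincare4.SmoothPoincare4.Theorems
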